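import Literature.NumberTheory.LFunctions.Zhang2022.ObjectiveTwinEllFrame
import Literature.NumberTheory.LFunctions.Zhang2022.ObjectiveTwinEllKernelForm

/-!
# Zhang (2022) design-space objective, twin part 8: the `K₀` instance of the frame law — one-piece
# exponential profiles `expComb k u` are `OnePieceWV`, their `F_ℓ` is the kernel pencil, and the closing
# hypothesis of `theorem1_of_ellDictK0` is a statement about the dictionary constants alone

Y. Zhang, *Discrete mean estimates and the Landau–Siegel zero*, arXiv:2211.02515v1 (2022)
[Zhang2022LandauSiegel] — an unrefereed manuscript under adjudication. **This file SEARCHES and TYPES; it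
makes no claim about Landau–Siegel zeros, about Theorems 1–2 of the manuscript, or about a repaired (2.32),
until a kernel theorem says so.** LANDAU–SIEGEL programme, cell `landau-siegel`, §A Lean twin; companion of
`ObjectiveTwinEllFrame` (scaling law, `OnePieceWV`, frame bounds) and `ObjectiveTwinEllKernelForm` (`F_ℓ|_K =
ellFormQ`), for the B-ell designs ell-K0-pos-001…003 and the endgame `EllRegime.theorem1_of_ellDictK0(C)` of
`EllRegimeStatements`. Proved here:

* `mainTermFormEll_congr` — `F_ℓ(G)` depends only on `G|[0,1]` and on `G′|(0,1)` (interval integrals and the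
  two boundary values), so the `if`-extended profiles of `EllRegimeStatements` may be replaced by their smooth
  formulas inside `F_ℓ`;
* `onePieceWV_expComb` — for every real shift triple `k` and every coefficient pattern with `Σ_j u_j = 0`
  (the `K₀` patterns), `(expComb k u, expComb' k u)` is a one-piece wall-vanishing profile (`OnePieceWV`):
  continuous across the wall, bounded measurable right derivative; hence (part 7) its rescaled main term is
  `≥ 0` at every regime record: `mainTerm_frame_nonneg_expComb`, and `hneg` forces a negative dictionary term;
* `dict_neg_of_hnegK0` — the `∃ D₁ ∀ S`-shaped closing hypothesis `hneg` of `theorem1_of_ellDictK0` IMPLIES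
  `(G₀ + λG₁)/A + K/A² < 0` for every `|λ| ≤ Λ` outright (instantiate at the explicit regime record
  `regimeRecord A D`): for `K₀` designs the endgame's last hypothesis is a constraint on `(G₀, G₁, K, Λ)` —
  registry row E-022∣K₀ — and on nothing else; likewise in the `C`-regime (`dict_neg_of_hnegK0C`, with
  `IsEllRegimePC.frame_bounds`);
* `mainTermFormEll_expComb_k123` / `mainTermFormEll_rescale_expComb_k123` — for the manuscript's shifts
  `k = (1,2,3)` the exact value: `F_ℓ(expComb) = ellFormQ ℓ (−u₀) (u₁) (−u₂)` and, for `Σu_j = 0`, `0 < r ≤ 1`,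
  `F_ℓ(rescale r expComb) = r⁻¹·ellFormQ (ℓr) (−u₀) (u₁) (−u₂)` (the cell's «K₀^P» numbers: e.g. `k₁ − k₃` at the
  limit point `ℓr = 1 − ε`, `ε = 1/(2A+1)`: `r⁻¹(32πε − 16πε² + 64πε³) > 0`).

STATUS OF THE OBJECTS as in parts 6–7 (continued main-term calculus at free scales; dictionary rows open,
asserted by no one). Two plumbing definitions (`k123`, `regimeRecord`/`regimeRecordC`); theorems otherwise.
-/

noncomputable section

open Real Complex ComplexConjugate MeasureTheory Set intervalIntegral Filter Topology

namespace Literature.NumberTheory.LFunctions.Zhang2022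

/-! ## `F_ℓ` sees only `G|[0,1]` and `G′|(0,1)` -/

/-- **Congruence for `F_ℓ`.** If `G = E` on `[0,1]` and `G′ = E′` on `(0,1)` then `F_ℓ(G) = F_ℓ(E)`: the five
ingredients of `mainTermFormEll` are interval integrals over `[0,1]` (blind to null sets) and the boundary values
`G(0), G(1)`. [cite: Zhang2022LandauSiegel, §2 (2.10), (2.13)] -/
theorem mainTermFormEll_congr {G G' E E' : ℝ → ℂ} (hG : EqOn G E (Icc 0 1)) (hG' : EqOn G' E' (Ioo 0 1))
    (ℓ : ℝ) : mainTermFormEll ℓ G G' = mainTermFormEll ℓ E E' := by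
  have h0 : G 0 = E 0 := hG ⟨le_rfl, zero_le_one⟩
  have h1 : G 1 = E 1 := hG ⟨zero_le_one, le_rfl⟩
  have hGo : EqOn G E (Ioo 0 1) := hG.mono Ioo_subset_Icc_self
  have i1 : ∫ y in (0:ℝ)..1, ‖G' y‖ ^ 2 = ∫ y in (0:ℝ)..1, ‖E' y‖ ^ 2 :=
    intervalIntegral.integral_congr_Ioo_of_le zero_le_one fun y hy => by simp only [hG' hy]
  have i2 : ∫ y in (0:ℝ)..1, G' y * conj (G y) = ∫ y in (0:ℝ)..1, E' y * conj (E y) :=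
    intervalIntegral.integral_congr_Ioo_of_le zero_le_one fun y hy => by simp only [hG' hy, hGo hy]
  have i3 : ∫ y in (0:ℝ)..1, ‖G y‖ ^ 2 = ∫ y in (0:ℝ)..1, ‖E y‖ ^ 2 :=
    intervalIntegral.integral_congr_Ioo_of_le zero_le_one fun y hy => by simp only [hGo hy]
  have i4 : ∫ y in (0:ℝ)..1, G y = ∫ y in (0:ℝ)..1, E y :=
    intervalIntegral.integral_congr_Ioo_of_le zero_le_one fun y hy => hGo hy
  have i5 : ∫ y in (0:ℝ)..1, G y * conj (∫ t in (0:ℝ)..y, G t) =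
      ∫ y in (0:ℝ)..1, E y * conj (∫ t in (0:ℝ)..y, E t) := by
    refine intervalIntegral.integral_congr_Ioo_of_le zero_le_one fun y hy => ?_
    have hp : ∫ t in (0:ℝ)..y, G t = ∫ t in (0:ℝ)..y, E t :=
      intervalIntegral.integral_congr fun t ht => by
        rw [uIcc_of_le hy.1.le] at ht
        exact hG ⟨ht.1, ht.2.trans hy.2.le⟩
    simp only [hGo hy, hp]
  rw [mainTermFormEll, mainTermFormEll, i1, i2, i3, i4, i5, h0, h1]

namespace EllRegime

open EllScales

/-! ## `expComb k u` is a one-piece wall-vanishing profile when `Σ u_j = 0` -/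

section ExpComb

variable (k : Fin 3 → ℝ) (u : Fin 3 → ℂ)

/-- The smooth formula of `expComb` (no cut-off). [cite: Zhang2022LandauSiegel, §2 (2.23)–(2.25)] -/
private def expSum (y : ℝ) : ℂ := ∑ j, u j * cexp ((k j : ℂ) * π * I * ((1 - y : ℝ) : ℂ))

/-- The smooth formula of `expComb'`. [cite: Zhang2022LandauSiegel, §2 (2.23)–(2.25)] -/
private def expSum' (y : ℝ) : ℂ :=
  ∑ j, u j * (-((k j : ℂ) * π * I)) * cexp ((k j : ℂ) * π * I * ((1 - y : ℝ) : ℂ))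

/-- `expComb` as an `if` over the smooth formula. [folklore] -/
private theorem expComb_eq_ite (y : ℝ) : expComb k u y = if y ≤ 1 then expSum k u y else 0 := rfl

/-- `expComb'` as an `if` over the smooth formula. [folklore] -/
private theorem expComb'_eq_ite (y : ℝ) : expComb' k u y = if y < 1 then expSum' k u y else 0 := rfl

/-- The smooth formula is continuous. [folklore] -/
private theorem continuous_expSum : Continuous (expSum k u) := by
  unfold expSum; fun_prop

/-- The smooth derivative formula is continuous. [folklore] -/
private theorem continuous_expSum' : Continuous (expSum' k u) := by
  unfold expSum'; fun_prop

/-- The smooth formula has derivative `expSum'`. [folklore] -/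
private theorem hasDerivAt_expSum (y : ℝ) : HasDerivAt (expSum k u) (expSum' k u y) y := by
  unfold expSum expSum'
  refine HasDerivAt.fun_sum fun j _ => ?_
  have h1 : HasDerivAt (fun y : ℝ => ((1 - y : ℝ) : ℂ)) ((-1 : ℝ) : ℂ) y :=
    ((hasDerivAt_id y).const_sub 1 |>.ofReal_comp).congr_deriv (by simp)
  have h2 : HasDerivAt (fun y : ℝ => (k j : ℂ) * π * I * ((1 - y : ℝ) : ℂ)) ((k j : ℂ) * π * I * ((-1 : ℝ) : ℂ)) y :=
    h1.const_mul _
  have h3 := (h2.cexp).const_mul (u j)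
  refine h3.congr_deriv ?_
  push_cast
  ring

/-- Wall value: `expSum k u 1 = Σ u_j`. [folklore] -/
private theorem expSum_one (hu : ∑ j, u j = 0) : expSum k u 1 = 0 := by
  unfold expSum
  simp only [sub_self, Complex.ofReal_zero, mul_zero, Complex.exp_zero, mul_one]
  exact hu

/-- The exponent `k_jπ(1−y)·i` is purely imaginary, so `‖e^{…}‖ = 1`. [folklore] -/
private theorem norm_cexp_phase (j : Fin 3) (y : ℝ) : ‖cexp ((k j : ℂ) * π * I * ((1 - y : ℝ) : ℂ))‖ = 1 := by
  rw [Complex.norm_exp]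
  simp

/-- Uniform bound `‖expSum'‖ ≤ Σ ‖u_j‖·|k_j|π`. [folklore] -/
private theorem norm_expSum'_le (y : ℝ) : ‖expSum' k u y‖ ≤ ∑ j, ‖u j‖ * (|k j| * π) := by
  unfold expSum'
  refine (norm_sum_le _ _).trans (Finset.sum_le_sum fun j _ => ?_)
  rw [norm_mul, norm_mul, norm_cexp_phase, mul_one, norm_neg]
  have : ‖(k j : ℂ) * π * I‖ = |k j| * π := by
    rw [norm_mul, norm_mul, Complex.norm_real, Complex.norm_real, Complex.norm_I, Real.norm_eq_abs,
      Real.norm_eq_abs, abs_of_pos Real.pi_pos, mul_one]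
  rw [this]

/-- **`K₀` profiles are one-piece wall-vanishing profiles**: for every real shift triple `k` and every
coefficient pattern with `Σ_j u_j = 0`, `(expComb k u, expComb' k u)` satisfies `OnePieceWV`.
[cite: Zhang2022LandauSiegel, §2 (2.23)–(2.25)] -/
theorem onePieceWV_expComb {u : Fin 3 → ℂ} (hu : ∑ j, u j = 0) : OnePieceWV (expComb k u) (expComb' k u) where
  continuous := by
    have e : expComb k u = fun y => if y ≤ 1 then expSum k u y else 0 := funext (expComb_eq_ite k u)
    rw [e]
    exact (continuous_expSum k u).if_le continuous_const continuous_id continuous_const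
      (fun y hy => by rw [hy, expSum_one k u hu])
  eq_zero := fun y hy => by
    rw [expComb_eq_ite]
    by_cases h : y ≤ 1
    · rw [if_pos h, le_antisymm h hy, expSum_one k u hu]
    · rw [if_neg h]
  deriv_eq_zero := fun y hy => by rw [expComb'_eq_ite, if_neg (not_lt.mpr hy)]
  hasDerivWithinAt := fun x hx => by
    rcases lt_or_ge x 1 with hx1 | hx1
    · -- interior point: `expComb = expSum` near `x`
      have hev : expComb k u =ᶠ[𝓝 x] expSum k u :=
        Filter.eventuallyEq_of_mem (Iio_mem_nhds hx1) fun y hy => by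
          rw [expComb_eq_ite, if_pos (le_of_lt hy)]
      have hd := (hasDerivAt_expSum k u x).congr_of_eventuallyEq hev
      rw [expComb'_eq_ite, if_pos hx1]
      exact hd.hasDerivWithinAt
    · -- at or beyond the wall: locally zero on the right
      have hz : ∀ y ∈ Ioi x, expComb k u y = (fun _ => (0:ℂ)) y := fun y hy => by
        rw [expComb_eq_ite, if_neg (not_le.mpr (lt_of_le_of_lt hx1 hy))]
      have hx0 : expComb k u x = (fun _ => (0:ℂ)) x := by
        rw [expComb_eq_ite]
        by_cases h : x ≤ 1
        · rw [if_pos h, le_antisymm h hx1, expSum_one k u hu]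
        · rw [if_neg h]
      rw [expComb'_eq_ite, if_neg (not_lt.mpr hx1)]
      exact (hasDerivWithinAt_const x (Ioi x) (0:ℂ)).congr hz hx0
  measurable := by
    have e : expComb' k u = fun y => if y < 1 then expSum' k u y else 0 := funext (expComb'_eq_ite k u)
    rw [e]
    exact Measurable.ite measurableSet_Iio (continuous_expSum' k u).measurable measurable_const
  bounded := ⟨∑ j, ‖u j‖ * (|k j| * π), fun y => by
    rw [expComb'_eq_ite]
    by_cases h : y < 1
    · rw [if_pos h]; exact norm_expSum'_le k u y
    · rw [if_neg h, norm_zero]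
      exact Finset.sum_nonneg fun j _ => by positivity⟩

end ExpComb

/-! ## Frame bounds (regime-free and in the `C`-regime) and the `K₀` endgame consequence -/

/-- **Frame bounds from raw scale data**: `log P > 0`, `t₀ ≥ 1`, `D ≥ 7` give `0 < L_M/L_R ≤ 1`, `0 < ℓ(P)`,
`0 < ℓ(P)·(L_M/L_R) < 1`. [cite: Zhang2022LandauSiegel, §2 (2.6), (2.8), (2.10), (2.30)] -/
theorem _root_.Literature.NumberTheory.LFunctions.Zhang2022.EllScales.Scales.frame_bounds_of (S : Scales)
    (hP : 0 < S.logP) (ht : 1 ≤ S.t0) (hD : 7 ≤ S.D) :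
    0 < S.shrink ∧ S.shrink ≤ 1 ∧ 0 < S.ellP ∧ 0 < S.ellP * S.shrink ∧ S.ellP * S.shrink < 1 := by
  have hD7 : (7 : ℝ) ≤ S.D := by exact_mod_cast hD
  have hD0 : (0 : ℝ) < S.D := by linarith
  have ht0' : 0 < S.t0 := by linarith
  have hlogt : 0 ≤ Real.log S.t0 := Real.log_nonneg ht
  have hsqrt : 0 < Real.log (Real.sqrt S.D) := by
    rw [Real.log_sqrt hD0.le]
    have : 0 < Real.log S.D := Real.log_pos (by linarith)
    linarith
  have h2π : Real.log (2 * π) < Real.log S.D := by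
    apply Real.log_lt_log (by positivity)
    have := Real.pi_lt_d2
    linarith
  have hΔ : S.logP < S.LDelta S.P := by rw [S.LDelta_P_eq hD0 ht0']; linarith
  have hΔ0 : 0 < S.LDelta S.P := by linarith
  have hR : S.logP ≤ S.LRefl S.P := by rw [S.LRefl_P_eq hD0 ht0']; linarith
  have hR0 : 0 < S.LRefl S.P := by linarith
  have hshrink0 : 0 < S.shrink := by unfold Scales.shrink; exact div_pos hP hR0
  have hshrink1 : S.shrink ≤ 1 := by unfold Scales.shrink; rw [div_le_one hR0]; exact hR
  have hell0 : 0 < S.ellP := by unfold Scales.ellP Scales.ell; exact div_pos hR0 hΔ0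
  refine ⟨hshrink0, hshrink1, hell0, mul_pos hell0 hshrink0, ?_⟩
  rw [S.ellP_mul_shrink hR0.ne', div_lt_one hΔ0]
  exact hΔ

/-- **Frame bounds in the `C`-regime** (`t₀ = D^C·𝓛⁵¹⁹`, `C ≥ 0`; `A > 0`, `D ≥ 7`).
[cite: Zhang2022LandauSiegel, §2 (2.6), (2.8), (2.10), (2.30)] -/
theorem _root_.Literature.NumberTheory.LFunctions.Zhang2022.EllScales.Scales.IsEllRegimePC.frame_bounds
    {S : Scales} {A C : ℝ} (h : S.IsEllRegimePC A C) (hA : 0 < A) (hC : 0 ≤ C) (hD : 7 ≤ S.D) :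
    0 < S.shrink ∧ S.shrink ≤ 1 ∧ 0 < S.ellP ∧ 0 < S.ellP * S.shrink ∧ S.ellP * S.shrink < 1 := by
  obtain ⟨hP, ht0, -, -, -⟩ := h
  have hD7 : (7 : ℝ) ≤ S.D := by exact_mod_cast hD
  have hD0 : (0 : ℝ) < S.D := by linarith
  have hlogD : 1 < Real.log S.D := by
    rw [← Real.exp_lt_exp, Real.exp_log hD0]
    have := Real.exp_one_lt_d9
    linarith
  refine S.frame_bounds_of ?_ ?_ hD
  · rw [hP]; exact mul_pos hA (by linarith)
  · rw [ht0]
    have h1 : 1 ≤ Real.exp (C * Real.log S.D) := Real.one_le_exp (mul_nonneg hC (by linarith))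
    have h2 : 1 ≤ Real.log S.D ^ 519 := one_le_pow₀ hlogD.le
    nlinarith

variable {G G' : ℝ → ℂ}

/-- The main term of `hneg` is `≥ 0` at every record of the `C`-regime (`A > 0`, `C ≥ 0`, `D ≥ 7`).
[cite: Zhang2022LandauSiegel, §2 (2.10) p.4 (zero spacing α = π/log P), (2.30)] -/
theorem mainTerm_frame_nonnegC (h : OnePieceWV G G') {S : Scales} {A C : ℝ} (hS : S.IsEllRegimePC A C)
    (hA : 0 < A) (hC : 0 ≤ C) (hD : 7 ≤ S.D) :
    0 ≤ mainTermFormEll S.ellP (rescale S.shrink G) (rescale' S.shrink G') := by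
  obtain ⟨hs0, hs1, hl0, -, hprod⟩ := hS.frame_bounds hA hC hD
  exact mainTermFormEll_rescale_nonneg h hs0 hs1 hl0 hprod.le

/-- `C`-regime form of `dict_neg_of_hneg`. [cite: Zhang2022LandauSiegel, §2 (2.10), (2.30); §8 (8.23)] -/
theorem dict_neg_of_hnegC (h : OnePieceWV G G') {S : Scales} {A C G₀ G₁ Λ K : ℝ} (hS : S.IsEllRegimePC A C)
    (hA : 0 < A) (hC : 0 ≤ C) (hD : 7 ≤ S.D)
    (hneg : ∀ lam : ℝ, |lam| ≤ Λ →
      mainTermFormEll S.ellP (rescale S.shrink G) (rescale' S.shrink G') + (G₀ + lam * G₁) / A + K / A ^ 2 < 0)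
    {lam : ℝ} (hlam : |lam| ≤ Λ) : (G₀ + lam * G₁) / A + K / A ^ 2 < 0 := by
  have h0 := mainTerm_frame_nonnegC h hS hA hC hD
  have h1 := hneg lam hlam
  linarith

/-- **The explicit regime record** `(D, log P = A log D, pinned secondary scales)` — a witness that scale records
of the `P`-side regime exist at every `D` (used to instantiate `∃ D₁ ∀ S`-shaped hypotheses).
[cite: Zhang2022LandauSiegel, §2 (2.6), (2.8), (2.15)] -/
def regimeRecord (A : ℝ) (D : ℕ) : Scales := { Scales.pinned D with logP := A * Real.log D }

/-- `regimeRecord A D` is a record of the `P`-side regime. [cite: Zhang2022LandauSiegel, §2 (2.6), (2.8), (2.15)] -/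
theorem isEllRegimeP_regimeRecord (A : ℝ) (D : ℕ) : (regimeRecord A D).IsEllRegimeP A :=
  ⟨rfl, rfl, rfl, rfl, rfl⟩

/-- The explicit record of the `C`-regime at `D`. [cite: Zhang2022LandauSiegel, §2 (2.6), (2.8), (2.15)] -/
def regimeRecordC (A C : ℝ) (D : ℕ) : Scales :=
  { Scales.pinned D with logP := A * Real.log D, t0 := Real.exp (C * Real.log D) * Real.log D ^ 519 }

/-- `regimeRecordC A C D` is a record of the `C`-regime. [cite: Zhang2022LandauSiegel, §2 (2.6), (2.8), (2.15)] -/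
theorem isEllRegimePC_regimeRecordC (A C : ℝ) (D : ℕ) : (regimeRecordC A C D).IsEllRegimePC A C :=
  ⟨rfl, rfl, rfl, rfl, rfl⟩

/-- **The closing hypothesis of the one-profile endgame is a statement about the dictionary alone.** For a
one-piece wall-vanishing profile and `A > 0`, the `∃ D₁ ∀ S`-shaped hypothesis `hneg` of
`theorem1_of_ellDictProfile` implies `(G₀ + λG₁)/A + K/A² < 0` for every `|λ| ≤ Λ`.
[cite: Zhang2022LandauSiegel, §2 (2.10), (2.30); §8 (8.23)] -/
theorem dict_neg_of_hnegProfile (h : OnePieceWV G G') {A G₀ G₁ Λ K : ℝ} (hA : 0 < A)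
    (hneg : ∃ D₁ : ℕ, ∀ S : Scales, D₁ ≤ S.D → S.IsEllRegimeP A → ∀ lam : ℝ, |lam| ≤ Λ →
      mainTermFormEll S.ellP (rescale S.shrink G) (rescale' S.shrink G') + (G₀ + lam * G₁) / A + K / A ^ 2 < 0)
    {lam : ℝ} (hlam : |lam| ≤ Λ) : (G₀ + lam * G₁) / A + K / A ^ 2 < 0 := by
  obtain ⟨D₁, hD₁⟩ := hneg
  set D : ℕ := max D₁ 7 with hDdef
  have hS := isEllRegimeP_regimeRecord A D
  have hDge : D₁ ≤ (regimeRecord A D).D := le_max_left _ _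
  have hD7 : 7 ≤ (regimeRecord A D).D := le_max_right _ _
  exact dict_neg_of_hneg h hS hA hD7 (hD₁ _ hDge hS) hlam

/-- **`K₀` form**: for shifts `k` and a coefficient pattern with `Σ u_j = 0`, the hypothesis `hneg` of
`theorem1_of_ellDictK0` implies `(G₀ + λG₁)/A + K/A² < 0` for all `|λ| ≤ Λ` — a `K₀`-POS design closes in the
physical frame only through a negative first-order dictionary term (registry row E-022∣K₀).
[cite: Zhang2022LandauSiegel, §2 (2.10), (2.23)–(2.25), (2.30); §8 (8.23)] -/
theorem dict_neg_of_hnegK0 (k : Fin 3 → ℝ) {u : Fin 3 → ℂ} (hu : ∑ j, u j = 0) {A G₀ G₁ Λ K : ℝ} (hA : 0 < A)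
    (hneg : ∃ D₁ : ℕ, ∀ S : Scales, D₁ ≤ S.D → S.IsEllRegimeP A → ∀ lam : ℝ, |lam| ≤ Λ →
      mainTermFormEll S.ellP (rescale S.shrink (expComb k u)) (rescale' S.shrink (expComb' k u))
        + (G₀ + lam * G₁) / A + K / A ^ 2 < 0)
    {lam : ℝ} (hlam : |lam| ≤ Λ) : (G₀ + lam * G₁) / A + K / A ^ 2 < 0 :=
  dict_neg_of_hnegProfile (onePieceWV_expComb k hu) hA hneg hlam

/-- `C`-regime `K₀` form (`C ≥ 0`). [cite: Zhang2022LandauSiegel, §2 (2.10), (2.23)–(2.25), (2.30); §8 (8.23)] -/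
theorem dict_neg_of_hnegK0C (k : Fin 3 → ℝ) {u : Fin 3 → ℂ} (hu : ∑ j, u j = 0) {A C G₀ G₁ Λ K : ℝ}
    (hA : 0 < A) (hC : 0 ≤ C)
    (hneg : ∃ D₁ : ℕ, ∀ S : Scales, D₁ ≤ S.D → S.IsEllRegimePC A C → ∀ lam : ℝ, |lam| ≤ Λ →
      mainTermFormEll S.ellP (rescale S.shrink (expComb k u)) (rescale' S.shrink (expComb' k u))
        + (G₀ + lam * G₁) / A + K / A ^ 2 < 0)
    {lam : ℝ} (hlam : |lam| ≤ Λ) : (G₀ + lam * G₁) / A + K / A ^ 2 < 0 := by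
  obtain ⟨D₁, hD₁⟩ := hneg
  set D : ℕ := max D₁ 7 with hDdef
  have hS := isEllRegimePC_regimeRecordC A C D
  have hDge : D₁ ≤ (regimeRecordC A C D).D := le_max_left _ _
  have hD7 : 7 ≤ (regimeRecordC A C D).D := le_max_right _ _
  exact dict_neg_of_hnegC (onePieceWV_expComb k hu) hS hA hC hD7 (hD₁ _ hDge hS) hlam

/-- The main term of the `K₀` endgame is `≥ 0` at every regime record (`A > 0`, `D ≥ 7`).
[cite: Zhang2022LandauSiegel, §2 (2.10), (2.23)–(2.25), (2.30)] -/
theorem mainTerm_frame_nonneg_expComb (k : Fin 3 → ℝ) {u : Fin 3 → ℂ} (hu : ∑ j, u j = 0) {S : Scales}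
    {A : ℝ} (hS : S.IsEllRegimeP A) (hA : 0 < A) (hD : 7 ≤ S.D) :
    0 ≤ mainTermFormEll S.ellP (rescale S.shrink (expComb k u)) (rescale' S.shrink (expComb' k u)) :=
  mainTerm_frame_nonneg (onePieceWV_expComb k hu) hS hA hD

/-! ## The manuscript's shifts `k = (1,2,3)`: exact values via the kernel pencil -/

/-- The shift triple `(1, 2, 3)` of the three AFE directions `k_j(y) = e^{−iπjy}` (the `K₀` designs' shifts).
[cite: Zhang2022LandauSiegel, §2 (2.13), (2.23)–(2.25)] -/
def k123 : Fin 3 → ℝ := ![1, 2, 3]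

/-- `e^{mπi(1−y)} = (−1)^m·k_m(y)`. [cite: Zhang2022LandauSiegel, §2 (2.13)] -/
private theorem cexp_shift (m : ℕ) (y : ℝ) :
    cexp ((m : ℂ) * π * I * ((1 - y : ℝ) : ℂ)) = (-1) ^ m * afeDir m y := by
  have e : (m : ℂ) * π * I * ((1 - y : ℝ) : ℂ) = (m : ℂ) * (π * I) + afeFreq m * y := by
    rw [afeFreq]; push_cast; ring
  rw [e, Complex.exp_add, Complex.exp_nat_mul, Complex.exp_pi_mul_I, afeDir]

/-- On `(−∞, 1]`, `expComb k123 u` is the kernel combination `(−u₀)k₁ + u₁k₂ + (−u₂)k₃`.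
[cite: Zhang2022LandauSiegel, §2 (2.13), (2.23)–(2.25)] -/
theorem expComb_k123_of_le_one (u : Fin 3 → ℂ) {y : ℝ} (hy : y ≤ 1) :
    expComb k123 u y = (-u 0) * afeDir 1 y + u 1 * afeDir 2 y + (-u 2) * afeDir 3 y := by
  rw [expComb, if_pos hy, Fin.sum_univ_three]
  have e0 : ((k123 0 : ℝ) : ℂ) = ((1 : ℕ) : ℂ) := by simp [k123]
  have e1 : ((k123 1 : ℝ) : ℂ) = ((2 : ℕ) : ℂ) := by simp [k123]
  have e2 : ((k123 2 : ℝ) : ℂ) = ((3 : ℕ) : ℂ) := by simp [k123]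
  rw [e0, e1, e2, cexp_shift 1, cexp_shift 2, cexp_shift 3]
  ring

/-- On `(−∞, 1)`, `expComb' k123 u` is the derivative combination `(−u₀)k₁′ + u₁k₂′ + (−u₂)k₃′`.
[cite: Zhang2022LandauSiegel, §2 (2.13), (2.23)–(2.25)] -/
theorem expComb'_k123_of_lt_one (u : Fin 3 → ℂ) {y : ℝ} (hy : y < 1) :
    expComb' k123 u y = (-u 0) * afeDir' 1 y + u 1 * afeDir' 2 y + (-u 2) * afeDir' 3 y := by
  rw [expComb', if_pos hy, Fin.sum_univ_three]
  have e0 : ((k123 0 : ℝ) : ℂ) = ((1 : ℕ) : ℂ) := by simp [k123]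
  have e1 : ((k123 1 : ℝ) : ℂ) = ((2 : ℕ) : ℂ) := by simp [k123]
  have e2 : ((k123 2 : ℝ) : ℂ) = ((3 : ℕ) : ℂ) := by simp [k123]
  simp only [afeDir']
  rw [e0, e1, e2, cexp_shift 1, cexp_shift 2, cexp_shift 3, afeFreq, afeFreq, afeFreq]
  push_cast
  ring

/-- **`F_ℓ` of a `K₀`-type profile with the manuscript's shifts is the kernel pencil**:
`F_ℓ(expComb (1,2,3) u) = ellFormQ ℓ (−u₀) u₁ (−u₂)` (any `u`, any `ℓ`).
[cite: Zhang2022LandauSiegel, §2 (2.10), (2.13), (2.23)–(2.25)] -/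
theorem mainTermFormEll_expComb_k123 (ℓ : ℝ) (u : Fin 3 → ℂ) :
    mainTermFormEll ℓ (expComb k123 u) (expComb' k123 u) = Objective.ellFormQ ℓ (-u 0) (u 1) (-u 2) := by
  rw [mainTermFormEll_congr (E := fun y => (-u 0) * afeDir 1 y + u 1 * afeDir 2 y + (-u 2) * afeDir 3 y)
      (E' := fun y => (-u 0) * afeDir' 1 y + u 1 * afeDir' 2 y + (-u 2) * afeDir' 3 y)
      (fun y hy => expComb_k123_of_le_one u hy.2) (fun y hy => expComb'_k123_of_lt_one u hy.2)]
  exact Objective.mainTermFormEll_afeComb ℓ _ _ _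

/-- **The `K₀^P` value in closed form**: for `Σ u_j = 0` and `0 < r ≤ 1`,
`F_ℓ(rescale r (expComb (1,2,3) u)) = r⁻¹·ellFormQ (ℓr) (−u₀) u₁ (−u₂)` (scaling law + kernel pencil).
[cite: Zhang2022LandauSiegel, §2 (2.10), (2.13), (2.23)–(2.25), (2.30)] -/
theorem mainTermFormEll_rescale_expComb_k123 {u : Fin 3 → ℂ} (hu : ∑ j, u j = 0) (ℓ : ℝ) {r : ℝ}
    (hr : 0 < r) (hr1 : r ≤ 1) :
    mainTermFormEll ℓ (rescale r (expComb k123 u)) (rescale' r (expComb' k123 u)) =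
      r⁻¹ * Objective.ellFormQ (ℓ * r) (-u 0) (u 1) (-u 2) := by
  rw [mainTermFormEll_rescale (onePieceWV_expComb k123 hu) ℓ hr hr1, mainTermFormEll_expComb_k123]

/-- The design «K₀-POS-001» `k₁ − k₃` (`u = (−1, 0, 1)` in `expComb` coordinates, `Σ u_j = 0`): for
`0 < r ≤ 1`, `F_ℓ(rescale r (k₁ − k₃)) = r⁻¹·(1 − ℓr)·(32π − 16π(1−ℓr) + 64π(1−ℓr)²)` — POSITIVE whenever `ℓr < 1`
(the cell's «K₀^P > 0» reading in closed form). [cite: Zhang2022LandauSiegel, §2 (2.10), (2.13), (2.23)–(2.25), (2.30)] -/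
theorem mainTermFormEll_rescale_k13 (ℓ : ℝ) {r : ℝ} (hr : 0 < r) (hr1 : r ≤ 1) :
    mainTermFormEll ℓ (rescale r (expComb k123 ![-1, 0, 1])) (rescale' r (expComb' k123 ![-1, 0, 1])) =
      r⁻¹ * ((1 - ℓ * r) * (32 * π - 16 * π * (1 - ℓ * r) + 64 * π * (1 - ℓ * r) ^ 2)) := by
  have hu : ∑ j, (![-1, 0, 1] : Fin 3 → ℂ) j = 0 := by simp [Fin.sum_univ_three]
  rw [mainTermFormEll_rescale_expComb_k123 hu ℓ hr hr1]
  congr 1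
  simp [Objective.ellFormQ]
  ring

end EllRegime

end Literature.NumberTheory.LFunctions.Zhang2022
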